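import Summits.BirchSwinnertonDyer.Rank1Residual.Supersingular.X6VisibilityWitnessShape
import Summits.BirchSwinnertonDyer.Rank1Residual.Supersingular.LocalOddTorsionAdicCompletionAt
import Summits.BirchSwinnertonDyer.Rank1Residual.Supersingular.RationalLadder
import Summits.BirchSwinnertonDyer.Rank1Residual.X11b.VisibilityPrimeList
import Summits.BirchSwinnertonDyer.Rank1Residual.X11b.ChaPairsMinimality
import Summits.BirchSwinnertonDyer.BirchSwinnertonDyer.Theorems.Rank1ResidualIntModelReduction
import Summits.BirchSwinnertonDyer.BirchSwinnertonDyer.Theorems.Rank2ObservatoryReductionWitness3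
import Summits.BirchSwinnertonDyer.BirchSwinnertonDyer.Theorems.Rank2ObservatoryKernelAnnihilator
import Summits.BirchSwinnertonDyer.BirchSwinnertonDyer.Theorems.Rank2ObservatoryKernelPrimes
import Literature.NumberTheory.EllipticCurves.CongruenceVisibilityLocalFactors
import Literature.NumberTheory.EllipticCurves.Rank1Residual.Typed.X11Visibility
import Literature.NumberTheory.EllipticCurves.Rank1Residual.Typed.CasselsLowerBound
import HarnessLib

/-!
# Route `KatoDescentTamePotSupersingular` (rung K8-t′, cell `bsd-potss`), open core `TameLowerIntrinsicNonCM`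
# (item stmt-BirchSwinnertonDyer-19618), registered stub `stub_intr_residualNonCM` — the IRREDUCIBLE NON-SURJECTIVE
# rows at `p = 5`: L₀ PER CLASS by VISIBILITY for the two intrinsic `5Nn` classes `119025ck1`, `396900eb1`
# (a `--supports … --as helper` file; seat `bsd-potss-kt-pdesc` g2)

The stub `Sig.stub_intr_residualNonCM` (skeleton v5) asks `MissingLowerBoundAt W p` (Kato's LOWER inclusion,
`ord_p #Ш_an ≤ ord_p #Ш`) on the intrinsic non-CM (t′) rank-`0` rows whose mod-`p` image is NOT onto.  On the census
universe (b2b O5, `N < 5·10⁵`) the rows with `W[p]` IRREDUCIBLE and `ρ̄_{W,p}` not onto are exactly TWO single-curve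
classes, both with image the normaliser of a non-split Cartan subgroup at `p = 5` (`5Nn`), `#Ш_an = 25`, trivial
torsion: `119025ck1` (`N = 3²·5²·23²`, Kodaira `IV*` at `5`, `e = 3`) and `396900eb1` (`N = 2²·3⁴·5²·7²`, Kodaira `II`
at `5`, `e = 6`).  No descent engine reaches them (generation 0 of this seat).  This file certifies BOTH per class by
MAZUR VISIBILITY, with every road already in the tree (nothing is restated, no named fact is minted):

* the visible element of `Ш(W)[5]` from a `5`-CONGRUENT curve `F` — the kernel count
  `WeierstrassCurve.exists_sha_ne_zero_of_congr_of_rank` (`CongruenceVisibilityLocalFactors.lean`: Cremona–Mazur 2000 §3 /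
  Agashe–Stein 2002 Thm. 3.1 PROVED from the tree's Galois cohomology, NO condition on the reduction at `p`) for
  `119025ck1`, whose partner `F = 119025cl1` has rank `2`; and the NAMED-WITNESS form
  (`VisibleWitness.exists_sha_ne_zero_of_congr_of_witness`, b2b-bsdres x10b gen 26 / n1011-p09) for `396900eb1`, whose
  partner `F = 396900ec1` has rank `1` only, with its generator `P = (53179/25, 7658/125)` `5`-DIVISIBLE in `F(ℚ₅)`;
* then Cassels–Tate squareness (`missingLowerBoundAt_of_casselsTate_of_pow_dvd`, `hCT`) and GZK (`hGZK`: `W(ℚ)` and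
  `Ш(W)` finite at analytic rank `0`).

THE PARTNERS ARE THE CARTAN TWISTS (`ρ̄ ⊗ ε_M ≅ ρ̄` for an `Nn` image with Cartan field `M`): `119025cl1 = 119025ck1^{(−23)}`,
`396900ec1 = 396900eb1^{(−35)}` — kit j261046: engine A (PARI/GP) screened ALL 358 160 Cremona curves of rank `≥ 2`, `N ≤ 5·10⁵`,
plus the 52 073 curves with `rad N ⊆ {2,3,5,23}` / `{2,3,5,7}` (the twists are the ONLY `5`-congruent curves found) and ran the
Kraus–Oesterlé 1992 Prop. 4 criterion VERBATIM (`M = N`, `S = ∅`; all `ℓ ≤ 33119` resp. `≤ 181439`: PASS); engine B (python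
point counts, PARI-free) PASS identically; STEP-0 = Cremona–Mazur 2000 Table 1 rows `1058d1`, `2366f1`, `2834d1` reproduced.
As in every visibility record of the tree (`X4/VisibilityPair377600dn1.lean`, `Supersingular/X6VisibilityWitnessRecords01.lean`)
the `Γ_ℚ`-isomorphism `θ : F[5] ⥲ W[5]` is a displayed BINDER (evidence: the two-engine check + `W[5]` irreducible, kernel).

KERNEL (this file): `Δ ≠ 0` ×4, global minimality of `119025cl1`/`396900ec1` (Kraus bounded criterion), `W[5]`
irreducible for both targets (Frobenius witness `ℓ = 7`, `a₇ = 5`, resp. `ℓ = 11`, `a₁₁ = 6`), good reduction of both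
curves of a pair outside `S = {3,5,23}` resp. `{2,3,5,7}` (discriminant supports `3⁶5⁸23⁹ / 3⁶5⁸23³`,
`2⁸3¹⁰5²7⁹ / 2⁸3¹⁰5⁸7³`), `#F(ℚ_w)[5] = 1` at EVERY place of `S` (x10b's decider `fiveTorsionCheckAt`, certificates `k ≤ 2`,
empty ball lists: `ψ₅` has no `ℚ_w`-root), `2 ≤ rank 119025cl1(ℚ)` (generators `(144, 5103)`, `(328, −187)`, sum
`(5229/16, −11133/64)`; `two_le_mordellWeilRank_of_ratCert` with killers `(7, 13)`, `(11, 17)`, `t = 1`, doubling witnesses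
at `47, 17, 17`), and `P ∉ 5·F(ℚ)` for `396900ec1` (`N₁₉(F) = 15`, `3•P` by the `ℚ`-ladder, `19 ∤ den x(3P)`).
BINDERS: `hCT`, `hGZK`; Cremona's `r_an = 0` and `#Ш_an` (`hq`, `hv`); `θ`; for `396900eb1` ONE local datum `h5div`:
`P` has a fifth root in `F(ℚ₅)` — TRUE because `F(ℚ₅) ≅ ℤ₅` (Kodaira `IV*`, `c₅ = 1`, `F(ℚ₅)[5] = 0` by the same decider,
formal group torsion-free) so `5F(ℚ₅) = F₁(ℚ₅) ∋ P` (`v₅(x(P)) = −2`); the tree has no `[5]`-division over a completion,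
hence displayed.  HONEST LABEL: per-class certificates modulo Cassels–Tate + GZK and the displayed data; stub and item stay OPEN
(class-wide = Kato Conj. 12.10 at an additive potentially supersingular prime); nothing booked; BSD is not proved by any of this.
Evidence: HOME/kt-pdesc/g2/ (FINDING-19618-kt-pdesc-g2.md, SUMMARY-j261046.tsv, certs).

References: [CremonaMazur2000] §3, Table 1; [AgasheStein2002] Thm. 3.1; [KrausOesterle1992] Prop. 4; [SilvermanAEC2009] VII, VIII.6.7,
X.4.14; [Mazur1978] Prop. 6.3; [Kato2004Asterisque] Conj. 12.10; [Cremona2006].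
-/

set_option autoImplicit false
-- sibling precedent (`KatoDescentTamePotSupersingularTameLowerKimRoad.lean`): the directory name repeats the summit name
set_option linter.dupNamespace false

noncomputable section

open scoped Classical

open WeierstrassCurve Literature.NumberTheory.EllipticCurves
  Literature.NumberTheory.EllipticCurves.Rank1Residual
  Literature.NumberTheory.EllipticCurves.Rank1Residual.Typed
  Literature.NumberTheory.EllipticCurves.Rank1Residual.X11RankOneCertificates
  Summit.BirchSwinnertonDyer.BirchSwinnertonDyer.Rank1Residual.IntModel
  Summit.BirchSwinnertonDyer.BirchSwinnertonDyer.Rank1Residual.X11RankOne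
  Summit.BirchSwinnertonDyer.BirchSwinnertonDyer.Rank2Observatory
  Summit.BirchSwinnertonDyer.Rank1Residual.X11b
  Summit.BirchSwinnertonDyer.Rank1Residual.GaloisImage
  Summit.BirchSwinnertonDyer.Rank1Residual.Supersingular
  Summit.BirchSwinnertonDyer.Rank1Residual.Supersingular.LocalOddTorsion
open NumberField IsDedekindDomain Rat.HeightOneSpectrum

namespace Summit.BirchSwinnertonDyer.BirchSwinnertonDyer.Theorems.KTVis

/-! ## §1 The visible element from a NAMED witness, two local options (no Tate uniformisation, no Mazur–Rubin) -/

/-- **The visible element of `Ш(W/ℚ)[p]` from a named witness — options (a)/(i) only.**  `θ : F[p] ⥲ W[p]` a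
`Γ_ℚ`-isomorphism (`p` odd), `S` a finite set of places off which both curves are good and `w ∤ p`, `W(ℚ)` finite of
order prime to `p`, `P ∈ F(ℚ) ∖ pF(ℚ)`, and at every `w ∈ S` EITHER (a) `P` has a `p`-th root in `F(ℚ_w)` OR (i) `w ∤ p`
and `F(ℚ_w)[p] = 0`.  Then `Ш(W/ℚ)` has a non-zero element killed by `p` (x10b's
`exists_sha_ne_zero_of_congr_of_witness` with the Mazur–Rubin option (v) removed, so that no named fact is carried).
[cite: CremonaMazur2000, §3] [cite: AgasheStein2002, Lemma 3.6] -/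
theorem exists_sha_ne_zero_of_congr_of_witnessAI {W W' : WeierstrassCurve ℚ} [W.IsElliptic] [W'.IsElliptic]
    {p : ℕ} [Fact p.Prime] (hp : p ≠ 2) (θ : geomTorsion W' (p : ℤ) ≃+ geomTorsion W (p : ℤ))
    (hθ : ∀ (σ : Field.absoluteGaloisGroup ℚ) (P : geomTorsion W' (p : ℤ)), θ (σ • P) = σ • θ P)
    (S : Finset (HeightOneSpectrum (𝓞 ℚ)))
    (hS : ∀ w : HeightOneSpectrum (𝓞 ℚ), w ∉ S →
      W.HasGoodReductionAt w ∧ W'.HasGoodReductionAt w ∧ (p : 𝓞 ℚ) ∉ w.asIdeal)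
    (hfin : Finite W.toAffine.Point) (hcop : (Nat.card W.toAffine.Point).Coprime p)
    (P : W'.toAffine.Point)
    (hP : P ∉ (zsmulAddGroupHom (p : ℤ) : W'.toAffine.Point →+ W'.toAffine.Point).range)
    (hplaces : ∀ w ∈ S,
      (∃ Q : (W'.baseChange (w.adicCompletion ℚ)).toAffine.Point,
        p • Q = WeierstrassCurve.Affine.Point.baseChange (W' := W') ℚ (w.adicCompletion ℚ) P) ∨
      ((p : 𝓞 ℚ) ∉ w.asIdeal ∧ Nat.card (nsmulAddMonoidHom p :
          (W'.baseChange (w.adicCompletion ℚ)).toAffine.Point →+ _).ker = 1)) :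
    ∃ c : W.sha, c ≠ 0 ∧ p • c = 0 := by
  have hpp : p.Prime := Fact.out
  have hn : (p : ℤ) ≠ 0 := by exact_mod_cast hpp.ne_zero
  haveI := hfin
  have hdiv' : ∀ Q : geomPoints W', ∃ R : geomPoints W', (p : ℤ) • R = Q :=
    W'.zsmul_geomPoints_surjective_holds hn
  have hE : (zsmulAddGroupHom (p : ℤ) : W.toAffine.Point →+ W.toAffine.Point).range = ⊤ := by
    rw [← AddSubgroup.index_eq_one]
    exact index_range_zsmul_eq_one_of_coprime hcop
  exact VisibleWitness.exists_sha_ne_zero_of_congr_of_witness W W' hp θ hθ S hS hdiv' (by convert hE) P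
    (by convert hP) fun w hw ↦ by
    have hc : kummerMapTorsion W' (p : ℤ) hdiv' P ∈ selmerLocalKer W' (w.adicCompletion ℚ) (p : ℤ) :=
      kummerMapTorsion_mem_selmerLocalKer W' _ hdiv' _ P
    rcases hplaces w hw with ⟨Q, hQ⟩ | ⟨hwp, hloc⟩
    · exact VisibleWitness.h1Equiv_kummerMapTorsion_mem_selmerLocalKer_of_exists_smul_eq W W' θ hθ
        (w.adicCompletion ℚ) hn hdiv' P ⟨Q, by rw [natCast_zsmul]; exact hQ⟩
    · exact (relIndex_map_selmerLocalKer_eq_one_iff W W' θ hθ).mp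
        (relIndex_map_selmerLocalKer_eq_one_of_card_torsion_eq_one W W' θ hθ hwp hloc) _ hc

/-! ## §2 `119025ck1 @ 5` ← the rank-`2` Cartan twist `119025cl1` -/

/-- Killers for `119025cl1` = `[1,-1,0,-320742,69997041]` from the kernel counts `(ℓ, #F̃(𝔽_ℓ)) ∈ [(7, 13), (11, 17)]`
(`Δ = 3⁶·5⁸·23³`). [cite: SilvermanAEC2009, Prop. VII.3.1(b)] -/
theorem killers_c119025cl1 : ∀ ℓN ∈ [((7 : ℕ), (13 : ℕ)), (11, 17)], ℓN.1.Prime ∧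
    ∀ (x : ((⟨1, -1, 0, -320742, 69997041⟩ : WeierstrassCurve ℤ).map (Int.castRingHom ℚ)).toAffine.Point)
      (n : ℕ), ¬ ℓN.1 ∣ n → n • x = 0 → ℓN.2 • x = 0 :=
  killers_cons _ (q := 7) (N := 13) (by decide +kernel) (by decide +kernel)
    (killers_cons _ (q := 11) (N := 17) (by decide +kernel) (by decide +kernel) (killers_nil _))

/-- **`2 ≤ rank_ℤ F(ℚ)` for `F = 119025cl1` in the kernel** (Cremona's generators `P₁ = (144, 5103)`, `P₂ = (328, −187)`,
`P₁ + P₂ = (5229/16, −11133/64)`; trivial torsion: annihilator `t = 1` from `ℓ = 7, 11`; doubling witnesses: `x(P₁) ≡ 3 (47)`,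
`x(P₂) ≡ 5 (17)`, `x(P₁+P₂) ≡ 7 (17)` are not abscissae of doubles; `two_le_mordellWeilRank_of_ratCert`).
[cite: SilvermanAEC2009, Thm. VIII.6.7] [cite: Cremona2006, Table 1 (label 119025cl1)] -/
theorem two_le_rank_c119025cl1 :
    2 ≤ ((⟨1, -1, 0, -320742, 69997041⟩ : WeierstrassCurve ℤ).map (Int.castRingHom ℚ)).mordellWeilRank :=
  two_le_mordellWeilRank_of_ratCert _ (x₁ := 144) (y₁ := 5103) (x₂ := 328) (y₂ := -187)
    (x₃ := 5229 / 16) (y₃ := -11133 / 64) (by norm_num) (by norm_num) (by norm_num) (by decide +kernel)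
    (t := 1) (by decide) killers_c119025cl1 (by decide +kernel) 47 17 17
    (by decide +kernel) (by decide +kernel) (by decide +kernel)
    (by norm_num) (by norm_num) (by norm_num) 3 27 5 0 7 8
    (by norm_num) (by norm_num) (by norm_num)
    (by decide +kernel) (by decide +kernel) (by decide +kernel)

/-- **L₀ at `5` for `119025ck1` by VISIBILITY** (`N = 119025 = 3²·5²·23²`, (t′) at `5`: Kodaira `IV*`, `e = 3`; image `5Nn`;
`r_an = 0`, `#Ш_an = 25`, torsion `1`; the single curve of its isogeny class): `MissingLowerBoundAt W 5` from Cassels–Tate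
(`hCT`), GZK (`hGZK`), Cremona's `r_an = 0` / `#Ш_an` (`hr0`, `hq`, `hv`) and a `Γ_ℚ`-isomorphism `θ : F[5] ⥲ W[5]` from the
RANK-2 partner `F = 119025cl1 = W^{(−23)}` (Kraus–Oesterlé: `a_ℓ(W) ≡ a_ℓ(F) (mod 5)` for all `ℓ ≤ 33119`, `ℓ ∉ {3,5,23}`, two
engines, kit j261046).  KERNEL: `W[5]` irreducible (`ℓ = 7`, `#W̃(𝔽₇) = 3`, `X² − 5X + 7` has no root mod `5`), `S = {3, 5, 23}`
with good reduction outside, `#F(ℚ_w)[5] = 1` at `w = 3, 5, 23` (decider), `2 ≤ rank F(ℚ)` (`two_le_rank_c119025cl1`);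
count `[W(ℚ):5W(ℚ)]·∏_{w∈S} #𝓛_w(F) = 1·5 < 25 ≤ [F(ℚ):5F(ℚ)]` (`exists_sha_ne_zero_of_congr_of_rank`), so `Ш(W)[5] ≠ 0` and
`25 ∣ #Ш(W)` by Cassels–Tate: `ord₅ #Ш ≥ 2 = ord₅ #Ш_an`.  Per class; the stub / item are NOT closed; nothing booked.
[cite: CremonaMazur2000, §3 and Table 1] [cite: AgasheStein2002, Thm. 3.1] [cite: KrausOesterle1992, Prop. 4]
[cite: Mazur1978, Prop. 6.3 (1)] [cite: SilvermanAEC2009, VII.5 Prop. 5.1(a), Thm. X.4.14] [cite: Cremona2006, Table 1 (labels 119025ck1, 119025cl1)] -/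
theorem missingLower5_vis_119025ck1 (hCT : exists_casselsTate_pairing (K := ℚ))
    (hGZK : rank_eq_analyticRank_of_analyticRank_le_one)
    (W : WeierstrassCurve ℚ) [W.IsElliptic] [W.IsGloballyMinimal] (hWeq : W = ⟨1, -1, 0, -169672617, -850635962334⟩)
    (hr0 : W.analyticRank = 0) {q : ℚ} (hq : shaAn W = (q : ℂ)) (hv : padicValRat 5 q ≤ 2)
    (F : WeierstrassCurve ℚ) (hFeq : F = ⟨1, -1, 0, -320742, 69997041⟩)
    (θ : geomTorsion F (5 : ℤ) ≃+ geomTorsion W (5 : ℤ))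
    (hθ : ∀ (σ : Field.absoluteGaloisGroup ℚ) (P : geomTorsion F (5 : ℤ)), θ (σ • P) = σ • θ P) :
    MissingLowerBoundAt W 5 := by
  haveI hFell : F.IsElliptic := by
    rw [hFeq]
    exact Summit.BirchSwinnertonDyer.Rank1Residual.X11b.isElliptic_of_discOf_ne_zero 1 (-1) 0 (-320742) 69997041
      (by decide +kernel)
  have hIW : integralModelInt W = ⟨1, -1, 0, -169672617, -850635962334⟩ :=
    integralModelInt_eq_of_map_eq _ (by rw [hWeq]; exact map_mk_int 1 (-1) 0 (-169672617) (-850635962334))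
  -- `W[5]` irreducible: Frobenius witness at `ℓ = 7` (`#W̃(𝔽₇) = 3`, `a₇ = 5`)
  have hirr : Irr W 5 :=
    hasIrreducibleModPGaloisRep_of_intModel_of_noroot hIW 5 7 (by norm_num) (by decide +kernel)
      (natCard_point_eq_of_countPoints 1 (-1) 0 (-169672617) (-850635962334) 7 (by norm_num)
        (by decide +kernel) (n := 3) (by decide +kernel)) (by decide)
  haveI hfin : Finite W.toAffine.Point := finite_point_of_analyticRank_eq_zero W hGZK hr0
  have hcop : (Nat.card W.toAffine.Point).Coprime 5 := coprime_natCard_point_of_irr W 5 hirr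
  have hrank : Module.finrank ℚ ℚ + 1 ≤ F.mordellWeilRank := by
    have h2 := two_le_rank_c119025cl1
    have hE : (⟨1, -1, 0, -320742, 69997041⟩ : WeierstrassCurve ℤ).map (Int.castRingHom ℚ) =
        (⟨1, -1, 0, -320742, 69997041⟩ : WeierstrassCurve ℚ) := by
      ext <;> simp [WeierstrassCurve.map]
    rw [hE] at h2
    rw [Module.finrank_self, hFeq]
    exact h2
  have h3 : ∀ w : HeightOneSpectrum (𝓞 ℚ), (primesEquiv w : ℕ) = 3 →
      Nat.card (nsmulAddMonoidHom 5 : (F.baseChange (w.adicCompletion ℚ)).toAffine.Point →+ _).ker = 1 :=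
    fun w hw ↦ by
      exact natCard_ker_nsmul_five_adicCompletion_eq_one_of_checkAt 3 1 (-1) 0 (-320742) 69997041 (by decide +kernel)
        (k := 2) (cert := []) (by decide +kernel) F hFeq hw
  have h5 : ∀ w : HeightOneSpectrum (𝓞 ℚ), (primesEquiv w : ℕ) = 5 →
      Nat.card (nsmulAddMonoidHom 5 : (F.baseChange (w.adicCompletion ℚ)).toAffine.Point →+ _).ker = 1 :=
    fun w hw ↦
      natCard_ker_nsmul_five_adicCompletion_eq_one_of_checkAt 5 1 (-1) 0 (-320742) 69997041 (by decide +kernel)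
        (k := 2) (cert := []) (by decide +kernel) F hFeq hw
  have h23 : ∀ w : HeightOneSpectrum (𝓞 ℚ), (primesEquiv w : ℕ) = 23 →
      Nat.card (nsmulAddMonoidHom 5 : (F.baseChange (w.adicCompletion ℚ)).toAffine.Point →+ _).ker = 1 :=
    fun w hw ↦ by
      exact natCard_ker_nsmul_five_adicCompletion_eq_one_of_checkAt 23 1 (-1) 0 (-320742) 69997041 (by decide +kernel)
        (k := 1) (cert := []) (by decide +kernel) F hFeq hw
  set L : List ℕ := [3, 5, 23] with hL
  have hLp : ∀ r ∈ L, r.Prime := by decide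
  have hΔE : ∀ r : ℕ, r.Prime → (r : ℤ) ∣ (⟨1, -1, 0, -169672617, -850635962334⟩ : WeierstrassCurve ℤ).Δ → r ∈ L :=
    forall_mem_of_natAbs_eq_prod_pow L [6, 8, 9] hLp (by decide +kernel)
  have hΔF : ∀ r : ℕ, r.Prime → (r : ℤ) ∣ (⟨1, -1, 0, -320742, 69997041⟩ : WeierstrassCurve ℤ).Δ → r ∈ L :=
    forall_mem_of_natAbs_eq_prod_pow L [6, 8, 3] hLp (by decide +kernel)
  set e := primesEquiv (R := 𝓞 ℚ) with he
  set S : Finset (HeightOneSpectrum (𝓞 ℚ)) :=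
    (L.filterMap fun r ↦ if h : r.Prime then some (e.symm ⟨r, h⟩) else none).toFinset with hSdef
  have hmemS : ∀ w : HeightOneSpectrum (𝓞 ℚ), w ∈ S ↔ (e w : ℕ) ∈ L := by
    intro w
    rw [hSdef, List.mem_toFinset, List.mem_filterMap]
    constructor
    · rintro ⟨r, hr, hrw⟩
      by_cases hrp : r.Prime
      · rw [dif_pos hrp, Option.some.injEq] at hrw
        rw [← hrw, Equiv.apply_symm_apply]; exact hr
      · rw [dif_neg hrp] at hrw; exact absurd hrw (by simp)
    · intro hw
      refine ⟨(e w : ℕ), hw, ?_⟩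
      rw [dif_pos (e w).2]; simp
  have hS : ∀ w : HeightOneSpectrum (𝓞 ℚ), w ∉ S →
      W.HasGoodReductionAt w ∧ F.HasGoodReductionAt w ∧ ((5 : ℕ) : 𝓞 ℚ) ∉ w.asIdeal := by
    intro w hwS
    have hwL : (e w : ℕ) ∉ L := fun h ↦ hwS ((hmemS w).mpr h)
    have hqp : (e w : ℕ).Prime := (e w).2
    refine ⟨?_, ?_, natCast_not_mem_of_primesEquiv_ne w Fact.out fun h ↦ hwL ?_⟩
    · rw [hWeq]; exact hasGoodReductionAt_mk_of_primesEquiv _ _ _ _ _ w rfl fun h ↦ hwL (hΔE _ hqp h)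
    · rw [hFeq]; exact hasGoodReductionAt_mk_of_primesEquiv _ _ _ _ _ w rfl fun h ↦ hwL (hΔF _ hqp h)
    · show (primesEquiv w : ℕ) ∈ L
      rw [h]; decide
  have hloc : ∀ w ∈ S, Nat.card (nsmulAddMonoidHom 5 :
      (F.baseChange (w.adicCompletion ℚ)).toAffine.Point →+ _).ker = 1 := by
    intro w hwS
    have hwL : (e w : ℕ) ∈ L := (hmemS w).mp hwS
    have hcases : (e w : ℕ) = 3 ∨ (e w : ℕ) = 5 ∨ (e w : ℕ) = 23 := by
      simp only [hL, List.mem_cons, List.mem_nil_iff, or_false] at hwL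
      omega
    rcases hcases with hw | hw | hw
    · exact h3 w hw
    · exact h5 w hw
    · exact h23 w hw
  obtain ⟨c, hc0, hc5⟩ :=
    WeierstrassCurve.exists_sha_ne_zero_of_congr_of_rank W F (by norm_num) θ hθ S hS hfin hcop hrank hloc
  have hfinSha : W.ShaFinite := (hGZK W (by rw [hr0]; norm_num)).2
  exact missingLowerBoundAt_of_casselsTate_of_pow_dvd W 5 hCT hfinSha hq (k := 1) (by simpa using hv)
    (by simpa using dvd_shaOrder_of_exists_torsion W 5 ⟨c, hc0, hc5⟩)

/-! ## §3 `396900eb1 @ 5` ← the rank-`1` Cartan twist `396900ec1` and its generator, `5`-divisible in `F(ℚ₅)` -/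

/-- **The witness is not `5`-divisible in `F(ℚ)` (kernel).**  On `F = 396900ec1 = [0,0,0,-13584375,19271148750]` Cremona's
generator `P = (53179/25, 7658/125)` satisfies `P ∉ 5·F(ℚ)`: at the good prime `19` (`Δ_F = 2⁸·3¹⁰·5⁸·7³`) `N₁₉ = #F̃(𝔽₁₉) = 15`,
and `(15/5)·P = 3P` (one double-and-add step of the `ℚ`-ladder, slopes supplied) is affine with `19 ∤ den x(3P)`
(`not_mem_range_zsmul_of_reductionCert`). [cite: SilvermanAEC2009, Prop. VII.2.1] [cite: Cremona2006, Table 1 (label 396900ec1)] -/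
theorem not_mem_range_zsmul_witness_c396900ec1 (F : WeierstrassCurve ℚ) [F.IsElliptic] [F.IsGloballyMinimal]
    (hFeq : F = ⟨0, 0, 0, -13584375, 19271148750⟩)
    (hT : F.toAffine.Nonsingular ((53179 : ℚ) / 25) ((7658 : ℚ) / 125)) :
    (Affine.Point.some _ _ hT : F.toAffine.Point) ∉
      (zsmulAddGroupHom ((5 : ℕ) : ℤ) : F.toAffine.Point →+ F.toAffine.Point).range := by
  subst hFeq
  have hI : integralModelInt (⟨0, 0, 0, -13584375, 19271148750⟩ : WeierstrassCurve ℚ) =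
      ⟨0, 0, 0, -13584375, 19271148750⟩ :=
    integralModelInt_eq_of_map_eq _ (by ext <;> simp [WeierstrassCurve.map])
  have hN : (⟨0, 0, 0, -13584375, 19271148750⟩ : WeierstrassCurve ℚ).reductionPointCount 19 = 15 :=
    reductionPointCount_eq_of_intModel_countPoints hI 19 (by norm_num) (by decide +kernel) (by decide +kernel)
  obtain ⟨hR, eR⟩ := nsmul_some_eq_of_ladderRunQ (W := (⟨0, 0, 0, -13584375, 19271148750⟩ : WeierstrassCurve ℚ))
    (xf := (7657254207929697114289 : ℚ) / 3768887618688536100)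
    (yf := (55835005586240876432904612463087 : ℚ) / 7316776373547575613614391000) hT
    [⟨true, (-222009 : ℚ) / 2735, (17464725259 : ℚ) / 7480225, (343546559705098 : ℚ) / 20458415375,
      (85573298836391 : ℚ) / 1061925183570, (7657254207929697114289 : ℚ) / 3768887618688536100,
      (55835005586240876432904612463087 : ℚ) / 7316776373547575613614391000⟩] (by decide +kernel)
  rw [show qScalar 1 _ = 3 from by decide] at eR
  refine not_mem_range_zsmul_of_reductionCert _ 19 (not_dvd_minimalDiscriminantInt_of_intModel hI (by decide +kernel))
    (by rw [hN]; norm_num) _ hR ?_ (by decide +kernel)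
  rw [hN]
  exact eR

/-- **L₀ at `5` for `396900eb1` by VISIBILITY, WITNESS ROAD** (`N = 396900 = 2²·3⁴·5²·7²`, (t′) at `5`: Kodaira `II`, `e = 6`;
image `5Nn`; `r_an = 0`, `#Ш_an = 25`, torsion `1`; single-curve class): `MissingLowerBoundAt W 5` from Cassels–Tate (`hCT`),
GZK (`hGZK`), Cremona's `r_an = 0` / `#Ш_an` (`hr0`, `hq`, `hv`), a `Γ_ℚ`-isomorphism `θ : F[5] ⥲ W[5]` from the RANK-1 partner
`F = 396900ec1 = W^{(−35)}` (Kraus–Oesterlé to `181439`, two engines, kit j261046) and ONE local datum `h5div`: the generator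
`P = (53179/25, 7658/125)` of `F(ℚ)` has a fifth root in `F(ℚ₅)` (`F(ℚ₅) ≅ ℤ₅`: `IV*`, `c₅ = 1`, `F(ℚ₅)[5] = 0`; `v₅(x(P)) = −2`,
so `P ∈ F₁(ℚ₅) = 5F(ℚ₅)`).  No rank datum: the transported Kummer class of `P` is Selmer for `W` at `2, 3, 7` because
`#F(ℚ_w)[5] = 1` (decider, kernel), at `5` by `h5div`, elsewhere by good reduction, and it is non-zero because `P ∉ 5F(ℚ)`
(kernel: `not_mem_range_zsmul_witness_c396900ec1`).  KERNEL also: `W[5]` irreducible (`ℓ = 11`, `#W̃(𝔽₁₁) = 6`, `X² − 6X + 11`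
rootless mod `5`), supports `2⁸3¹⁰5²7⁹ / 2⁸3¹⁰5⁸7³`, minimality and `Δ ≠ 0` of `F`.  Then `Ш(W)[5] ≠ 0` and Cassels–Tate give
`ord₅ #Ш ≥ 2 = ord₅ #Ш_an`.  (Unconditionally the local conditions of `W` and `F` at `5` DIFFER — `dim Sel₅(W)` is even,
`dim Sel₅(F)` odd — so the count road cannot pay the place `5` with `rank F = 1`; the witness road needs exactly `h5div`.)
Per class; the stub / item are NOT closed; nothing booked.  [cite: CremonaMazur2000, §3 and Table 1] [cite: AgasheStein2002, Lemma 3.6]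
[cite: KrausOesterle1992, Prop. 4] [cite: Mazur1978, Prop. 6.3 (1)] [cite: SilvermanAEC2009, VII.2.1, VII.5 Prop. 5.1(a), Thm. X.4.14]
[cite: Cremona2006, Table 1 (labels 396900eb1, 396900ec1)] -/
theorem missingLower5_vis_396900eb1 (hCT : exists_casselsTate_pairing (K := ℚ))
    (hGZK : rank_eq_analyticRank_of_analyticRank_le_one)
    (W : WeierstrassCurve ℚ) [W.IsElliptic] [W.IsGloballyMinimal] (hWeq : W = ⟨0, 0, 0, -26625375, -52880032170⟩)
    (hr0 : W.analyticRank = 0) {q : ℚ} (hq : shaAn W = (q : ℂ)) (hv : padicValRat 5 q ≤ 2)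
    (F : WeierstrassCurve ℚ) (hFeq : F = ⟨0, 0, 0, -13584375, 19271148750⟩)
    (θ : geomTorsion F (5 : ℤ) ≃+ geomTorsion W (5 : ℤ))
    (hθ : ∀ (σ : Field.absoluteGaloisGroup ℚ) (P : geomTorsion F (5 : ℤ)), θ (σ • P) = σ • θ P)
    (h5div : ∀ w : HeightOneSpectrum (𝓞 ℚ), (primesEquiv w : ℕ) = 5 →
      ∀ hT : F.toAffine.Nonsingular ((53179 : ℚ) / 25) ((7658 : ℚ) / 125),
        ∃ Q : (F.baseChange (w.adicCompletion ℚ)).toAffine.Point,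
          5 • Q = WeierstrassCurve.Affine.Point.baseChange (W' := F) ℚ (w.adicCompletion ℚ) (.some _ _ hT)) :
    MissingLowerBoundAt W 5 := by
  haveI hFell : F.IsElliptic := by
    rw [hFeq]
    exact Summit.BirchSwinnertonDyer.Rank1Residual.X11b.isElliptic_of_discOf_ne_zero 0 0 0 (-13584375) 19271148750
      (by decide +kernel)
  haveI hFmin : F.IsGloballyMinimal := by
    rw [hFeq]
    exact isGloballyMinimal_of_krausCriterion_bounded 0 0 0 (-13584375) 19271148750
      (by decide +kernel) (by decide +kernel) (by decide +kernel)
  have hIW : integralModelInt W = ⟨0, 0, 0, -26625375, -52880032170⟩ :=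
    integralModelInt_eq_of_map_eq _ (by rw [hWeq]; exact map_mk_int 0 0 0 (-26625375) (-52880032170))
  -- `W[5]` irreducible: Frobenius witness at `ℓ = 11` (`#W̃(𝔽₁₁) = 6`, `a₁₁ = 6`)
  have hirr : Irr W 5 :=
    hasIrreducibleModPGaloisRep_of_intModel_of_noroot hIW 5 11 (by norm_num) (by decide +kernel)
      (natCard_point_eq_of_countPoints 0 0 0 (-26625375) (-52880032170) 11 (by norm_num)
        (by decide +kernel) (n := 6) (by decide +kernel)) (by decide)
  haveI hfin : Finite W.toAffine.Point := finite_point_of_analyticRank_eq_zero W hGZK hr0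
  have hcop : (Nat.card W.toAffine.Point).Coprime 5 := coprime_natCard_point_of_irr W 5 hirr
  have hT : F.toAffine.Nonsingular ((53179 : ℚ) / 25) ((7658 : ℚ) / 125) :=
    (WeierstrassCurve.Affine.equation_iff_nonsingular (W := F.toAffine)).mp
      (by rw [hFeq]; exact (WeierstrassCurve.Affine.equation_iff _ _).mpr (by norm_num))
  have hTP := not_mem_range_zsmul_witness_c396900ec1 F hFeq hT
  have h2 : ∀ w : HeightOneSpectrum (𝓞 ℚ), (primesEquiv w : ℕ) = 2 →
      Nat.card (nsmulAddMonoidHom 5 : (F.baseChange (w.adicCompletion ℚ)).toAffine.Point →+ _).ker = 1 :=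
    fun w hw ↦
      natCard_ker_nsmul_five_adicCompletion_eq_one_of_checkAt 2 0 0 0 (-13584375) 19271148750 (by decide +kernel)
        (k := 2) (cert := []) (by decide +kernel) F hFeq hw
  have h3 : ∀ w : HeightOneSpectrum (𝓞 ℚ), (primesEquiv w : ℕ) = 3 →
      Nat.card (nsmulAddMonoidHom 5 : (F.baseChange (w.adicCompletion ℚ)).toAffine.Point →+ _).ker = 1 :=
    fun w hw ↦
      natCard_ker_nsmul_five_adicCompletion_eq_one_of_checkAt 3 0 0 0 (-13584375) 19271148750 (by decide +kernel)
        (k := 2) (cert := []) (by decide +kernel) F hFeq hw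
  have h7 : ∀ w : HeightOneSpectrum (𝓞 ℚ), (primesEquiv w : ℕ) = 7 →
      Nat.card (nsmulAddMonoidHom 5 : (F.baseChange (w.adicCompletion ℚ)).toAffine.Point →+ _).ker = 1 :=
    fun w hw ↦
      natCard_ker_nsmul_five_adicCompletion_eq_one_of_checkAt 7 0 0 0 (-13584375) 19271148750 (by decide +kernel)
        (k := 1) (cert := []) (by decide +kernel) F hFeq hw
  set L : List ℕ := [2, 3, 5, 7] with hL
  have hLp : ∀ r ∈ L, r.Prime := by decide
  have hΔE : ∀ r : ℕ, r.Prime → (r : ℤ) ∣ (⟨0, 0, 0, -26625375, -52880032170⟩ : WeierstrassCurve ℤ).Δ → r ∈ L :=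
    forall_mem_of_natAbs_eq_prod_pow L [8, 10, 2, 9] hLp (by decide +kernel)
  have hΔF : ∀ r : ℕ, r.Prime → (r : ℤ) ∣ (⟨0, 0, 0, -13584375, 19271148750⟩ : WeierstrassCurve ℤ).Δ → r ∈ L :=
    forall_mem_of_natAbs_eq_prod_pow L [8, 10, 8, 3] hLp (by decide +kernel)
  set e := primesEquiv (R := 𝓞 ℚ) with he
  set S : Finset (HeightOneSpectrum (𝓞 ℚ)) :=
    (L.filterMap fun r ↦ if h : r.Prime then some (e.symm ⟨r, h⟩) else none).toFinset with hSdef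
  have hmemS : ∀ w : HeightOneSpectrum (𝓞 ℚ), w ∈ S ↔ (e w : ℕ) ∈ L := by
    intro w
    rw [hSdef, List.mem_toFinset, List.mem_filterMap]
    constructor
    · rintro ⟨r, hr, hrw⟩
      by_cases hrp : r.Prime
      · rw [dif_pos hrp, Option.some.injEq] at hrw
        rw [← hrw, Equiv.apply_symm_apply]; exact hr
      · rw [dif_neg hrp] at hrw; exact absurd hrw (by simp)
    · intro hw
      refine ⟨(e w : ℕ), hw, ?_⟩
      rw [dif_pos (e w).2]; simp
  have hS : ∀ w : HeightOneSpectrum (𝓞 ℚ), w ∉ S →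
      W.HasGoodReductionAt w ∧ F.HasGoodReductionAt w ∧ ((5 : ℕ) : 𝓞 ℚ) ∉ w.asIdeal := by
    intro w hwS
    have hwL : (e w : ℕ) ∉ L := fun h ↦ hwS ((hmemS w).mpr h)
    have hqp : (e w : ℕ).Prime := (e w).2
    refine ⟨?_, ?_, natCast_not_mem_of_primesEquiv_ne w Fact.out fun h ↦ hwL ?_⟩
    · rw [hWeq]; exact hasGoodReductionAt_mk_of_primesEquiv _ _ _ _ _ w rfl fun h ↦ hwL (hΔE _ hqp h)
    · rw [hFeq]; exact hasGoodReductionAt_mk_of_primesEquiv _ _ _ _ _ w rfl fun h ↦ hwL (hΔF _ hqp h)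
    · show (primesEquiv w : ℕ) ∈ L
      rw [h]; decide
  have hplaces : ∀ w ∈ S,
      (∃ Q : (F.baseChange (w.adicCompletion ℚ)).toAffine.Point,
        5 • Q = WeierstrassCurve.Affine.Point.baseChange (W' := F) ℚ (w.adicCompletion ℚ) (.some _ _ hT)) ∨
      (((5 : ℕ) : 𝓞 ℚ) ∉ w.asIdeal ∧ Nat.card (nsmulAddMonoidHom 5 :
          (F.baseChange (w.adicCompletion ℚ)).toAffine.Point →+ _).ker = 1) := by
    intro w hwS
    have hwL : (e w : ℕ) ∈ L := (hmemS w).mp hwS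
    have hcases : (e w : ℕ) = 2 ∨ (e w : ℕ) = 3 ∨ (e w : ℕ) = 5 ∨ (e w : ℕ) = 7 := by
      simp only [hL, List.mem_cons, List.mem_nil_iff, or_false] at hwL
      omega
    rcases hcases with hw | hw | hw | hw
    · exact Or.inr ⟨natCast_not_mem_of_primesEquiv_ne w Fact.out (by rw [hw]; decide), h2 w hw⟩
    · exact Or.inr ⟨natCast_not_mem_of_primesEquiv_ne w Fact.out (by rw [hw]; decide), h3 w hw⟩
    · exact Or.inl (h5div w hw hT)
    · exact Or.inr ⟨natCast_not_mem_of_primesEquiv_ne w Fact.out (by rw [hw]; decide), h7 w hw⟩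
  obtain ⟨c, hc0, hc5⟩ :=
    exists_sha_ne_zero_of_congr_of_witnessAI (by norm_num) θ hθ S hS hfin hcop (.some _ _ hT) hTP hplaces
  have hfinSha : W.ShaFinite := (hGZK W (by rw [hr0]; norm_num)).2
  exact missingLowerBoundAt_of_casselsTate_of_pow_dvd W 5 hCT hfinSha hq (k := 1) (by simpa using hv)
    (by simpa using dvd_shaOrder_of_exists_torsion W 5 ⟨c, hc0, hc5⟩)

end Summit.BirchSwinnertonDyer.BirchSwinnertonDyer.Theorems.KTVis

end
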